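import Mathlib.FieldTheory.PrimitiveElement
import Mathlib.LinearAlgebra.Eigenspace.Minpoly
import Mathlib.RingTheory.Polynomial.Basic
import Mathlib.LinearAlgebra.DFinsupp
import Mathlib.Algebra.DirectSum.Module
import HarnessLib

/-!
# Decomposition of `E ⊗ K`-modules along the embeddings `K → E`

Let `K/P` be a finite separable field extension and `E/P` a field extension which *splits* `K`,
i.e. `K` has `[K : P]` distinct `P`-embeddings `τ : K → E` (hypothesis
`Fintype.card (K →ₐ[P] E) = finrank P K`).  For an `E`-vector space `U` with a commuting
`P`-linear action of `K` (a `P`-algebra homomorphism `θ : K → End_E U`, i.e. an `E ⊗_P K`-module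
structure) we PROVE the **eigenspace decomposition along the embeddings** — the module-theoretic
form of `E ⊗_P K ≅ ∏_τ E`:

* `eigenSub θ τ = {u | θ(f) u = τ(f) u for all f ∈ K}` (the `τ`-component `e_τ U`);
* `eigenSub_iSupIndep` — the components are independent;
* `iSup_eigenSub_eq_top` — they span `U` (primitive element `α`, the minimal polynomial of
  `α` has `[K : P]` distinct roots `τ(α)` in `E`, and `U = ker μ_α(θ α) = ⊕ ker(θ α - τ α)` by the
  coprime-kernel decomposition);
* consequences: existence and uniqueness of the decomposition `u = Σ_τ u_τ`
  (`exists_sum_eq`, `eq_zero_of_sum_eq_zero`), and `finrank_E U = Σ_τ finrank_E (e_τ U)`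
  (`finrank_eq_sum_finrank_eigenSub`); a counting lemma (`eq_of_sum_le_of_le`).

Used for `D_cris/D_dR` with coefficients: `D(ρ)` is an `E ⊗_{ℚ_p} K`-module (Patrikis 2019,
§2.3.1, "`D = ⊕_τ e_τ D`"; Barnet-Lamb–Gee–Geraghty–Taylor 2014, Notation).  Pure algebra;
no named facts, no `sorry`.

## References

* S. Patrikis, *Variations on a theorem of Tate*, Mem. AMS 258 (2019), §2.3.1. [Patrikis2019]
-/

noncomputable section

open Polynomial Module

namespace Literature.NumberTheory.GaloisRepresentations

namespace CoeffEigen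

variable {P K E : Type*} [Field P] [Field K] [Field E] [Algebra P K] [Algebra P E]
  {U : Type*} [AddCommGroup U] [Module E U] [Module P U] [IsScalarTower P E U] (θ : K →ₐ[P] Module.End E U)

/-- The **`τ`-component** `e_τ U = {u | θ(f) u = τ(f) • u for all f}` of an `E ⊗_P K`-module.
[cite: Patrikis2019, §2.3.1] -/
def eigenSub (τ : K →ₐ[P] E) : Submodule E U where
  carrier := {u | ∀ f : K, θ f u = τ f • u}
  add_mem' {u v} hu hv f := by rw [map_add, hu f, hv f, smul_add]
  zero_mem' f := by rw [map_zero, smul_zero]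
  smul_mem' c {u} hu f := by rw [map_smul, hu f, smul_comm]

/-- Membership in the `τ`-component. [folklore] -/
theorem mem_eigenSub_iff (τ : K →ₐ[P] E) (u : U) : u ∈ eigenSub θ τ ↔ ∀ f : K, θ f u = τ f • u := Iff.rfl

section Separable

variable [FiniteDimensional P K] [Algebra.IsSeparable P K]

/-- A power basis of `K/P` (primitive element). [folklore] -/
abbrev pb (P K : Type*) [Field P] [Field K] [Algebra P K] [FiniteDimensional P K] [Algebra.IsSeparable P K] :
    PowerBasis P K :=
  Field.powerBasisOfFiniteOfSeparable P K

/-- Polynomials in the generator act on a `θ(α)`-eigenvector by the value at the eigenvalue. [folklore] -/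
theorem aeval_gen_apply_of_eq (τ : K →ₐ[P] E) {u : U} (hu : θ (pb P K).gen u = τ (pb P K).gen • u) (q : P[X]) :
    θ (aeval (pb P K).gen q) u = τ (aeval (pb P K).gen q) • u := by
  by_cases hu0 : u = 0
  · rw [hu0, map_zero, smul_zero]
  have hvec : Module.End.HasEigenvector (θ (pb P K).gen) (τ (pb P K).gen) u :=
    ⟨(Module.End.mem_eigenspace_iff).2 hu, hu0⟩
  rw [← Polynomial.aeval_algHom_apply θ, ← Polynomial.aeval_map_algebraMap E,
    Module.End.aeval_apply_of_hasEigenvector hvec, Polynomial.eval_map, ← Polynomial.aeval_def,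
    Polynomial.aeval_algHom_apply τ]

/-- The `τ`-component is the eigenspace of `θ(α)` for the eigenvalue `τ(α)`, `α` a primitive
element. [folklore] -/
theorem eigenSub_eq_eigenspace (τ : K →ₐ[P] E) :
    eigenSub θ τ = (θ (pb P K).gen).eigenspace (τ (pb P K).gen) := by
  ext u
  rw [mem_eigenSub_iff, Module.End.mem_eigenspace_iff]
  refine ⟨fun h => h _, fun h f => ?_⟩
  obtain ⟨q, rfl⟩ := (pb P K).exists_eq_aeval' f
  exact aeval_gen_apply_of_eq θ τ h q

/-- **The components `e_τ U` are independent.** [folklore] -/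
theorem eigenSub_iSupIndep : iSupIndep (eigenSub θ) := by
  have hinj : Function.Injective fun τ : K →ₐ[P] E => τ (pb P K).gen := fun τ₁ τ₂ h => (pb P K).algHom_ext h
  have h := (Module.End.eigenspaces_iSupIndep (θ (pb P K).gen)).comp hinj
  have heq : (eigenSub θ) = (θ (pb P K).gen).eigenspace ∘ fun τ : K →ₐ[P] E => τ (pb P K).gen :=
    funext fun τ => eigenSub_eq_eigenspace θ τ
  rw [heq]
  exact h

omit [FiniteDimensional P K] [Algebra.IsSeparable P K] in
/-- Kernel decomposition for a product of distinct linear factors. [folklore] -/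
theorem iSup_ker_aeval_X_sub_C (T : Module.End E U) (R : Finset E) :
    ⨆ r ∈ R, LinearMap.ker (aeval T (X - C r)) = LinearMap.ker (aeval T (∏ r ∈ R, (X - C r))) := by
  classical
  induction R using Finset.induction_on with
  | empty =>
    rw [Finset.prod_empty, map_one, Module.End.one_eq_id, LinearMap.ker_id]
    simp
  | insert a R ha ih =>
    rw [Finset.iSup_insert, Finset.prod_insert ha, ih]
    refine Polynomial.sup_ker_aeval_eq_ker_aeval_mul_of_coprime T (IsCoprime.prod_right fun r hr => ?_)
    exact Polynomial.isCoprime_X_sub_C_of_isUnit_sub (sub_ne_zero_of_ne (ne_of_mem_of_not_mem hr ha).symm).isUnit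

omit [FiniteDimensional P K] [Algebra.IsSeparable P K] in
/-- `ker (T - r) = eigenspace`. [folklore] -/
theorem ker_aeval_X_sub_C (T : Module.End E U) (r : E) : LinearMap.ker (aeval T (X - C r)) = T.eigenspace r := by
  ext u
  rw [LinearMap.mem_ker, map_sub, aeval_X, aeval_C, LinearMap.sub_apply, Module.algebraMap_end_apply, sub_eq_zero,
    Module.End.mem_eigenspace_iff]

/-- **The components span**: if `E` splits `K` then `U = ⊕_τ e_τ U`. [cite: Patrikis2019, §2.3.1] -/
theorem iSup_eigenSub_eq_top (hcard : Fintype.card (K →ₐ[P] E) = Module.finrank P K) : ⨆ τ, eigenSub θ τ = ⊤ := by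
  classical
  set α := (pb P K).gen with hα
  set μ := minpoly P α with hμdef
  have hμ : μ.Monic := minpoly.monic (pb P K).isIntegral_gen
  have hμE : (μ.map (algebraMap P E)).Monic := hμ.map _
  have hdeg : (μ.map (algebraMap P E)).natDegree = Module.finrank P K := by
    rw [Polynomial.natDegree_map, hμdef, hα, (pb P K).natDegree_minpoly, (pb P K).finrank]
  -- the distinct roots
  set R : Finset E := (μ.aroots E).toFinset with hRdef
  have hRcard : R.card = Module.finrank P K := by
    rw [← hcard, Fintype.card_congr (pb P K).liftEquiv', Fintype.card_of_subtype R]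
    intro y
    rw [hRdef, Multiset.mem_toFinset]
  have hle1 : R.card ≤ Multiset.card (μ.aroots E) := Multiset.toFinset_card_le _
  have hle2 : Multiset.card (μ.aroots E) ≤ (μ.map (algebraMap P E)).natDegree := Polynomial.card_roots' _
  have hrootscard : Multiset.card (μ.aroots E) = (μ.map (algebraMap P E)).natDegree :=
    le_antisymm hle2 (by rw [hdeg, ← hRcard]; exact hle1)
  have hnodup : (μ.aroots E).Nodup := by
    rw [← Multiset.dedup_eq_self]
    refine Multiset.eq_of_le_of_card_le (Multiset.dedup_le _) ?_
    rw [← Multiset.toFinset_val, Finset.card_val, hRcard, ← hdeg, ← hrootscard]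
  have hprod : (∏ r ∈ R, (X - C r)) = μ.map (algebraMap P E) := by
    rw [Finset.prod_eq_multiset_prod, show R.val = μ.aroots E from by
      rw [hRdef, Multiset.toFinset_val, Multiset.dedup_eq_self.2 hnodup]]
    exact prod_multiset_X_sub_C_of_monic_of_roots_card_eq hμE hrootscard
  -- `μ(θ α) = 0`
  have hann : aeval (θ α) (μ.map (algebraMap P E)) = 0 := by
    rw [Polynomial.aeval_map_algebraMap, Polynomial.aeval_algHom_apply θ, hμdef, minpoly.aeval, map_zero]
  have htop : LinearMap.ker (aeval (θ α) (∏ r ∈ R, (X - C r))) = ⊤ := by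
    rw [hprod, hann, LinearMap.ker_zero]
  rw [← iSup_ker_aeval_X_sub_C] at htop
  -- every root is `τ α`
  refine top_le_iff.1 (htop ▸ iSup₂_le fun r hr => ?_)
  have hr' : r ∈ μ.aroots E := by rwa [hRdef, Multiset.mem_toFinset] at hr
  obtain ⟨τ, hτ⟩ := (pb P K).liftEquiv'.surjective ⟨r, hr'⟩
  have hτr : τ α = r := by
    have := congrArg Subtype.val hτ
    simpa [PowerBasis.liftEquiv'] using this
  rw [ker_aeval_X_sub_C, ← hτr, ← eigenSub_eq_eigenspace]
  exact le_iSup (eigenSub θ) τ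

/-- **Decomposition of elements**: `u = Σ_τ u_τ` with `u_τ ∈ e_τ U`. [folklore] -/
theorem exists_sum_eq (hcard : Fintype.card (K →ₐ[P] E) = Module.finrank P K) (u : U) :
    ∃ z : (K →ₐ[P] E) → U, (∀ τ, z τ ∈ eigenSub θ τ) ∧ ∑ τ, z τ = u := by
  classical
  have hu : u ∈ ⨆ τ ∈ (Finset.univ : Finset (K →ₐ[P] E)), eigenSub θ τ := by
    rw [show (⨆ τ ∈ (Finset.univ : Finset (K →ₐ[P] E)), eigenSub θ τ) = ⨆ τ, eigenSub θ τ from by simp,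
      iSup_eigenSub_eq_top θ hcard]
    trivial
  obtain ⟨μ, hμ⟩ := (Submodule.mem_iSup_finset_iff_exists_sum _ u).1 hu
  exact ⟨fun τ => μ τ, fun τ => (μ τ).2, hμ⟩

end Separable

/-- Independent families: a sum of elements of the pieces vanishes only trivially. [folklore] -/
theorem eq_zero_of_sum_eq_zero {ι : Type*} [Fintype ι] [DecidableEq ι] {V : ι → Submodule E U} (hV : iSupIndep V)
    (z : ι → U) (hz : ∀ i, z i ∈ V i) (hsum : ∑ i, z i = 0) (i : ι) : z i = 0 := by
  have h1 : z i = -∑ j ∈ Finset.univ.erase i, z j := by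
    rw [eq_neg_iff_add_eq_zero, add_comm, Finset.sum_erase_add _ _ (Finset.mem_univ i), hsum]
  have h2 : z i ∈ ⨆ j ≠ i, V j := by
    rw [h1]
    refine Submodule.neg_mem _ (Submodule.sum_mem _ fun j hj => ?_)
    exact Submodule.mem_iSup_of_mem j (Submodule.mem_iSup_of_mem (Finset.ne_of_mem_erase hj) (hz j))
  exact (Submodule.disjoint_def.1 (hV i) (z i) (hz i) h2)

section Finrank

variable [FiniteDimensional P K] [Algebra.IsSeparable P K]

/-- **`dim_E U = Σ_τ dim_E e_τ U`** for finite-dimensional `U` when `E` splits `K`. [cite: Patrikis2019, §2.3.1] -/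
theorem finrank_eq_sum_finrank_eigenSub [FiniteDimensional E U] (hcard : Fintype.card (K →ₐ[P] E) = Module.finrank P K) :
    Module.finrank E U = ∑ τ : K →ₐ[P] E, Module.finrank E (eigenSub θ τ) := by
  classical
  have hint : DirectSum.IsInternal (eigenSub θ) :=
    (DirectSum.isInternal_submodule_iff_iSupIndep_and_iSup_eq_top _).2
      ⟨eigenSub_iSupIndep θ, iSup_eigenSub_eq_top θ hcard⟩
  let b := hint.collectedBasis fun τ => Module.finBasis E (eigenSub θ τ)
  rw [Module.finrank_eq_card_basis b, Fintype.card_sigma]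
  simp only [Fintype.card_fin]

end Finrank

/-- Counting: if `Σ_i d_i ≤ n · #ι` and `n ≤ d_i` for all `i`, then `d_i = n`. [folklore] -/
theorem eq_of_sum_le_of_le {ι : Type*} [Fintype ι] {d : ι → ℕ} {n : ℕ} (hle : ∑ i, d i ≤ n * Fintype.card ι)
    (hge : ∀ i, n ≤ d i) (i : ι) : d i = n := by
  have hsum : ∑ _i : ι, n = n * Fintype.card ι := by rw [Finset.sum_const, Finset.card_univ, smul_eq_mul, mul_comm]
  have heq : ∑ i, d i = ∑ _i : ι, n := le_antisymm (hsum ▸ hle) (Finset.sum_le_sum fun i _ => hge i)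
  have h := (Finset.sum_eq_sum_iff_of_le fun i _ => hge i).1 heq.symm
  exact (h i (Finset.mem_univ i)).symm

end CoeffEigen

end Literature.NumberTheory.GaloisRepresentations

end
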